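import Mathlib
import HarnessLib
import HarnessLib.Audit
import Summits.HubbardSuperconductivity.Statement
import Literature.MathematicalPhysics.QuantumLattice.HubbardLiebConfig
import Literature.MathematicalPhysics.QuantumLattice.PairCorrelationsProofs
import HarnessLib.Audit.Status.Attr

/-!
Route: LiebTwin

DORMANT since 2026-08-26T07:15:53Z (reconciler: no traction for 8.4 d (last activity item-evidence-added at 2026-08-17T21:08:30Z); parked, not closed — `ledger route dormant route-HubbardSuperconductivity-LiebTwin --off` to reactivate) — unstaffed, not closed; items shared with open routes are served there. `ledger route dormant <id> --off` reactivates.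

# Route LiebTwin — Lieb's twin — transfer of the attractive-U spin-reflection proof; the rectified
Lieb matrix condenses on-site, ψ does not, the sign defect is d-polarised

TRANSFER LENS (sibling = the attractive-U Hubbard model, Lieb 1989 Thm 1 / Tian 1992 / Shen–Qiu–Tian
1994). Write a real, spin-flip-definite
(N_L, S^z=0)-sector ground state φ of hubbardTorus 2 L 1 U through its Lieb matrix W = liebW n φ (n
= N_L/2, real symmetric or antisymmetric)
and let the TWIN be φ̃ := liebVec n |W|, |W| = (WᴴW)^½ (Lean: CFC.abs) — at U<0 the twin IS the
ground state (Lieb), at U>0 it is the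
canonical sign-free reference of φ. It suffices to show X = K2 ∧ K3' ∧ NoOnsite: (K2,
TwinOnsiteCondensation) at some (U,δ) in the box
B = (0,4]×[1/10,3/10] the twin of EVERY such ground state is an ON-SITE s-wave condensate, F_s(φ̃)
:= Re⟨φ̃,P_s†P_s φ̃⟩ ≥ cL⁴
(P_g = pairField g L); (NoOnsiteODLRO, shared stmt-0933 of route EnslavedA1g) φ itself has none;
(K3', DWavePolarisedDiscordance) on all of
B the d-wave RECTIFICATION GAIN dominates a fixed fraction of the on-site rectification loss:
κ(F_s(φ̃)−F_s(φ)) − εL⁴ ≤ F_d(φ) − F_d(φ̃). By the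
card's identity calculus (lieb-involution-discordance-map (I3),(I4)) the two brackets are 4Σq and
4⟨−g_d⊗g_d,q⟩ for ONE nonnegative
discordance map q of the involution sgn W, so K3' says "the sign defect of φ is
d_(x²−y²)-polarised". Realises card lieb-involution-discordance-map
(its K2 = K2 here, its K3+mass = K3', its K1 = the consequence); shares NoOnsiteODLRO with
EnslavedA1g and UniformLROGivesSummitMatrix (proved) with IntrinsicLargeN.
Lean: `TwinOnsiteCondensation ∧ DWavePolarisedDiscordance ∧ NoOnsiteODLRO`

## Assembly
Pure logic (sorry-free in Sketch.lean, filed as glue.lean): closes (hK2 : TwinOnsiteCondensation)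
(hK3 : DWavePolarisedDiscordance) (hNo : NoOnsiteODLRO)
(hRed : RealFlipDefiniteSuffices) (hF : LiebTwinFloor) (hU : UniformLROGivesSummitMatrix) :
HubbardSuperconductivity — obtain ⟨U, 0<U, δ ∈ (0,1/2), a>0, L₀, floor⟩
:= hF hK2 hNo hK3 hRed; unfold the summit; close with ⟨U, _, δ, _, hU U δ ⟨a, _, L₀, floor⟩⟩. Every
crux is used (through hF).

Rationale: WHY THIS LINE. Lieb's proof for U<0 (LiebPRL1989, reprint book:editornd-hubbard-model pp.116–117:
eq. (3) E(W) = 2Tr KW² + Σ_x U_x Tr(W L_x W L_x), the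
inequality Tr WLWL ≤ Tr|W|L|W|L, "Since U_x ≤ 0 … E(W) ≥ E(|W|)") and its corollaries (Tian1992,
doi:10.1103/physrevlett.72.1280, Tian2004,
Miyao doi:10.1142/s0129055x11004424: correlations as traces of positive matrices, ODLRO on unequal
sublattices) transfer step by step to the
doped repulsive model EXCEPT ONE: for U>0 rectification W ↦ |W| RAISES the energy by 4UΣ_x
Tr(W₊L_xW₋L_x) ≥ 0 (filed, as the failure made
a theorem, in support RectificationRaisesEnergy), so the ground state is genuinely sign-indefinite
and every positivity tool of the sibling is
lost on φ — but not on the twin. The line keeps |W| as a REFERENCE and reads ORDER, not energy,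
through rectification: on-site pair
order can only grow under rectification ((I3), support OnsiteRectificationMonotone), d-wave order
changes by the d-moment of the sign defect
((I4)). S is thereby split into EXISTENCE (K2: pairing exists, channel-blind, a functional of the
one-species density matrix ρ_↑ = W² alone —
literally the sibling's own, still open but sign-free, s-wave LRO problem when U<0), EXCLUSION
(NoOnsite: only the sign of U), and SELECTION
(K3': which partition carries the defect — exact on the number-projected BCS anchor, supp q = gap
sign structure, card P2; visible in 4×4/10-site
ED, card jobs j002344–6, j002073). Imported: matrix analysis / operator-algebra positivity (Jordan
decomposition, cross Gram forms, CFC absolute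
value) in Lieb's spin-space representation; no expansion in U, no source field, no anchor
Hamiltonian, no reflection positivity in space. Nothing in
the negatives index (stmt-1180, stmt-1314) is touched.

RANKED CRUXES. #2 TwinOnsiteCondensation (crux) — K2 (card K2, boxed; the sibling's LRO statement
transported to the twin): there are (U,δ) ∈ (0,4]×[1/10,3/10], c>0, L₀ such that for every even L ≥
L₀ and every normalised (N_L,0)-sector ground state φ of hubbardTorus 2 L 1 U that is real with
liebW n φ symmetric or antisymmetric (n = ⌊(1−δ)L²/2⌋), the twin φ̃ = liebVec n (CFC.abs (liebW n
φ)) has c·L⁴ ≤ Re⟨φ̃, (pairField sWave L)ᴴ(pairField sWave L) φ̃⟩. [difficulty: open-problem] (why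
it might fail: no engine bounds a purification's pair coherence from below: ρ_↑ of a
Fermi-liquid/stripe ground state purifies to a state with only extensive F_s (a determinant purifies
to itself), and that may be the case at EVERY point of the box along some even L.) [LiebPRL1989,
Tian1992, doi:10.1103/physrevlett.72.1280, Tian2004, Yang1962, QinEtAl2020]
#3 DWavePolarisedDiscordance (crux) — K3' (card K3 + mass, typed q-free): for every (U,δ) in the box
there is κ>0 such that for every ε>0, eventually in even L, every real flip-definite normalised
sector ground state φ satisfies κ·(F_s(φ̃) − F_s(φ)) − εL⁴ ≤ F_d(φ) − F_d(φ̃), F_g(χ) :=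
Re⟨χ,(pairField g L)ᴴ(pairField g L)χ⟩, g ∈ {sWave, dWaveFormFactor} — a fixed fraction of the
discordance mass is nesting-odd with |g_d⊗g_d| weight (vacuous where the mass is o(L⁴)).
[difficulty: XL] (why it might fail: macroscopic discordance that is nesting-EVEN (extended-s or
d_xy pairing: seen on 10 sites at δ=0.4, outside the box) or sits near the nodal diagonals, or a PDW
putting the gain at q≠0, makes the d-gain o(mass) somewhere in (0,4]×[1/10,3/10].) [Scalapino1995,
RaghuKivelsonScalapino2010, DengEtAl2015, arXiv:1405.2184, QinEtAl2020]
#4 NoOnsiteODLRO (crux) — SHARED verbatim with route EnslavedA1g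
(stmt-HubbardSuperconductivity-0933): for all U>0, δ∈(0,1/2) and every admissible (N_L,S^z=0)
ground-state sequence, L⁻⁴Re⟨ψ_L, (pairField sWave L)ᴴ(pairField sWave L) ψ_L⟩ → 0 along even L — no
on-site k=0 pair condensate in the repulsive model (the EXCLUSION half; with K2 it makes the
discordance mass (F_s(φ̃)−F_s(φ))/4 macroscopic). [difficulty: L] (why it might fail: the universal
∀U ∀δ form is open: known only at half filling (KuboKishi1990, χ_pair ≤ 1/U) and in gHF
(BachLiebSolovej1994); at weak U every scale is e^(-c/U²), so only an exact sign-of-U argument can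
work, and Δ_s†Δ_s ≤ L²·D misses doublon condensation.) [KuboKishi1990, BachLiebSolovej1994,
Yang1989, Zhang1990, RaghuKivelsonScalapino2010]
#9 RealFlipDefiniteSuffices (support) — Lieb's "W Hermitian WLOG" step (p.116) as an order
statement: at fixed (U, L, n), if every normalised (2n,0)-sector ground state that is real with
liebW n φ symmetric or antisymmetric has F_d ≥ a, then EVERY normalised ground state has F_d ≥ a (H
and Δ_d†Δ_d are real and commute with the transpose involution W ↦ Wᵀ on the sector; the minimum of
the compressed quadratic form is attained on a real transpose-definite vector). [difficulty:
provable-now] [LiebPRL1989, Tasaki2020]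
#9 LiebTwinFloor (support) — the floor (provable now): K2 at its point (U,δ), NoOnsiteODLRO turned
uniform over ground states by a selection argument (a bad ground state at infinitely many L
assembles into an admissible sequence), K3' at (U,δ) with ε = κc/4 and F_d(φ̃) ≥ 0 give F_d(φ) ≥
(κc/4)L⁴ for every real flip-definite normalised ground state eventually; RealFlipDefiniteSuffices
extends it to every ground state; 0<U≤4 and [1/10,3/10] ⊂ (0,1/2) give the side conditions.
[difficulty: provable-now] [LiebPRL1989, Scalapino1995]
#9 UniformLROGivesSummitMatrix (support) — SHARED item stmt-HubbardSuperconductivity-10968 (route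
IntrinsicLargeN; PROVED, uniformLROGivesSummitMatrix_proof; identical signature): an eventual
uniform every-ground-state floor a·L⁴ ≤ Re⟨ψ,Δ_d†Δ_dψ⟩ at (U,δ) gives the summit's matrix at (U,δ).
[difficulty: provable-now] [Scalapino1995, Yang1962]
#9 OnsiteRectificationMonotone (support) — identity (I3) in inequality form (provable now): for
every real φ in the (n,n) sector with symmetric Lieb matrix, F_s(φ̃) ≥ F_s(φ) — on-site pair
annihilation acts as W ↦ ±Σ_x a_x W a_xᵀ, and F_s(|W|) − F_s(W) = 2Σ_(x,y)(‖W₊^½ a_xᵀa_y W₋^½‖² +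
‖W₋^½ a_xᵀa_y W₊^½‖²) ≥ 0 (the total discordance mass). [difficulty: provable-now] [LiebPRL1989,
Yang1962]
#9 RectificationRaisesEnergy (support) — the sibling's step that BREAKS, made a theorem (provable
now from Lieb eq. (3) and Tr WLWL ≤ Tr|W|L|W|L, tree LiebSpinReflection.re_trace_unitConj_mul_le):
for U ≥ 0 and every real φ in the (n,n) sector with symmetric Lieb matrix, the twin has the same
norm and energy Re⟨φ̃,Hφ̃⟩ ≥ Re⟨φ,Hφ⟩, H = hubbardTorus 2 L 1 U — rectification never lowers the
repulsive energy, so Lieb's positivity cannot be reached variationally and must be used as a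
reference. [difficulty: provable-now] [LiebPRL1989, BachLiebSolovej1994]

TWO-LAYER PLAN. Foreseen glued splits (not filed): TwinOnsiteCondensation ⇐ TwinIsAttractiveLike
(the twin's on-site pair correlations dominate those of the attractive sector ground state at a
renormalised coupling — the card's rectification duality, overlap 0.96–0.99999 on 4×4) →
AttractiveOnsiteLRO (the sibling's own open core: s-wave LRO of the Lieb-positive ground state of
hubbardTorus 2 L 1 (−U')) → TwinOnsiteCondensation. DWavePolarisedDiscordance ⇐ NestingOddSupport
(macroscopic part of q supported on g_d(k)g_d(k′)<0, card K3) → AntinodalWeight (that part carries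
|g_d⊗g_d|-weight ≥ κ) → DWavePolarisedDiscordance. NoOnsiteODLRO ⇐ EnslavedA1g's own plan
(Kubo–Kishi extension off half filling).

KILL CRITERIA. ¬TwinOnsiteCondensation on the whole box (every point has, along some even L, ground
states whose twin keeps only o(L⁴) on-site order) closes the route — and, by the card's shadow bound
F_d(ψ) ≤ 32F_s(ψ̃), is evidence against S on the box itself. ¬NoOnsiteODLRO (an on-site k=0 pair
condensate at some U>0) breaks this route and EnslavedA1g at once (pivot: restrict to the box).
¬DWavePolarisedDiscordance at a point of the box forces a pivot to a smaller box or to the channel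
the refuting ground states select; refuted on all of (0,4]×[1/10,3/10] ⇒ close
refuted:DWavePolarisedDiscordance. S proved at weak coupling elsewhere moots nothing here but fixes
the box.

NOT DECOMPOSED YET. The engine for K2 (any lower bound on a purification's pair coherence), the
rectification duality as a quantitative statement, the discordance map q itself as a tree object
(definition request below; the items are typed q-free through twins), constants κ, c, and the
identities (I1)–(I4) as equalities (only the two inequality shadows needed for grounding are filed).

CHEAPEST FALSIFIER. ED, already run by the card author (kit jobs j002344–6, j002548, j002066,
j002073, j002599–601): the d-gain F_d(ψ)−F_d(ψ̃) on 4×4 tori N=12 (δ=1/4) is +26.9 (U=2), +17.7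
(U=4), gone at U=8; on 10 sites δ=0.2 it is +4.3…+1.4 for U=0.5…12 while the twin's on-site F_s
rises 6.1→14.3 against ψ's 2.7→0.3 — K2/K3'/NoOnsite all point the right way at accessible size
inside the box; a NEGATIVE d-gain with macroscopic mass on the 18-site / N=14 clusters (card:
pending) at δ∈[0.1,0.3], U≤4 would kill K3'. Lookup falsifier: a theorem that doped repulsive ground
states are coherently indistinguishable from the purification of their species density matrix — none
found (searches below). In-Lean: nothing cheap (all statements asymptotic); Sketch.lean rc 0.

NUMBERS. Box B = (0,4]×[1/10,3/10] (weak-to-moderate coupling, doping where Kohn–Luttinger selects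
B1g at t'=0: RaghuKivelsonScalapino2010, DengEtAl2015 n ≳ 0.7; away from the stripe point (8,1/8) of
QinEtAl2020). BCS anchor (card P2, j002548): for number-projected d-BCS on 4×4, N=10, Δ₀ = 0.5/1/2:
d order 69.8/112.7/143.2 in ψ vs 13.3/11.6/10.5 in the twin, twin on-site order 12.5/19.3/24.9 vs
4.2/3.4/2.8 — κ ≈ (mean antinodal |g_d|)² = O(1). Items at open: 9.

DEFINITION REQUESTS. liebTwin n φ := liebVec n (CFC.abs (liebW n φ)), discordanceForm /
discordanceMap q_φ(k,k′) := ‖Ψ₊^½ dΓ(c†_k c_k′) Ψ₋^½‖_F² on the (n,n) sector (topic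
Literature/MathematicalPhysics/QuantumLattice; card D1) — wanted for the equality forms of (I3)/(I4)
and for card K3 proper; not needed by any item filed here.

Novelty: Searches (2026-08-16): in-pool — all 55 route files of the sub (theses + cruxes), 41 open + 124
closed card titles, full reads of lieb-involution-discordance-map, colour-the-spin-two-colour-qcd,
cooper-trial-violates-gs-stability, one-dimensional-oracle-audit,
variational-kohn-luttinger-dressed-bcs (title/grade); `lit vsearch` ×2 ("ODLRO ground state
attractive Hubbard rigorous", "Lieb two theorems … Tr WLWL ≤ Tr|W|L|W|L") → held reprint
book:editornd-hubbard-model pp.113–117 read; `lit search --source crossref` ×3 (Tian ODLRO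
negative-U: doi:10.1103/physrevb.45.3145; Shen–Qiu–Tian: doi:10.1103/physrevlett.72.1280,
doi:10.1103/physrevlett.71.4238; Miyao self-dual cone: doi:10.1142/s0129055x11004424); `lit galaxy
search "spin-reflection positivity" --star all` (1 hit, Lieb–Schupp frustrated spins), `… "spin
reflection positivity doped Hubbard" --star all` (0), `lit galaxy search --star pdf --mode bm25
"Lieb's theorem attractive Hubbard positive semidefinite matrix W repulsive"` (10, none off the
positive cone); searchd hybrid down (connection reset ×2), OpenAlex budget exhausted, S2 429 —
logged; the card's three novelty audits (zbMATH/crossref, 2026-08-15/16) credited.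
Nearest prior art found: LiebPRL1989 (|W| used for the ENERGY at U<0 — the on-model precedent of the
lever); Tian1992, doi:10.1103/physrevlett.72.1280, Tian2004, doi:10.1142/s0129055x11004424
(correlations via Lieb-matrix/self-dual-cone positivity ON the sign-definite plane); in-pool card
lieb-involution-discor  [refs: 10.1103/physrevb.45.3145, 10.1103/physrevlett.72.1280, 10.1103/physrevlett.71.4238, 10.1142/s0129055x11004424, book:editornd-hubbard-model, doi:10.1103/physrevb.45.3145, doi:10.1103/physrevlett.72.1280, doi:10.1103/physrevlett.71.4238, doi:10.1142/s0129055x11004424, LiebPRL1989, Tian1992, Tian2004]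

Barriers (technique_class: sign-rectification, SRP-transfer, positive-forms): - technique_class: sign-rectification, SRP-transfer, positive-forms
- Literature.Barriers.HubbardSuperconductivity.GeneralizedHartreeFockNoPairing: evaded — no
quasi-free state appears; the twin is as correlated as φ (same Schmidt moduli), and
RectificationRaisesEnergy is the many-body cousin of BLS's sign statement, used as a reference not
as a variational class.
- Literature.Barriers.HubbardSuperconductivity.PerturbativeInvisibilityOfPairing: evaded — K2/K3'
are fixed-(U,δ) statements on exact eigenvectors, no expansion in U is load-bearing (the card's O(U)
transfer-blindness theorem only calibrates: selection is born at O(U²)).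
- Literature.Barriers.HubbardSuperconductivity.WeakCouplingCeiling: not met — no convergent
expansion / temperature cutoff is used; the box reaches U = 4.
- Literature.Barriers.HubbardSuperconductivity.StrongCouplingCeiling: not met (U ≤ 4, T = 0, no
cluster expansion).
- Literature.Barriers.HubbardSuperconductivity.LROForcesLowLyingStates: evaded — statewise floor for
EVERY ground state, degeneracy handled by RealFlipDefiniteSuffices; no gap or uniqueness hypothesis.
- Literature.Barriers.HubbardSuperconductivity.PositiveTemperatureNoPairLRO: not met (T = 0 sector
ground states only); same for HohenbergMerminWagnerPairing.
- Literature.Barriers.HubbardSuperconductivity.SignProblemNPHard: not met — nothing is sampled; the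
sign structure (involution sgn W) is the CARRIER of the order, read through two inequalities.
- Literature.Barriers.HubbardSuperc

History (route lifecycle, newest last):
- 2026-08-16T15:20:32Z · rev 1: restated TwinOnsiteCondensation (stmt-HubbardSuperconductivity-15656) — rev 1a: restate TwinOnsiteCondensation over every normalised ground state (drop the reality/flip-definite hypotheses) ahead of the crux-only deciding theorem (planner-plan-lens-HubbardSuperconductivity-transfer-0)
- 2026-08-16T15:22:22Z · rev 2: restated DWavePolarisedDiscordance (stmt-HubbardSuperconductivity-15657) — rev 1b: restate DWavePolarisedDiscordance over every normalised ground state (drop the reality/flip-definite hypotheses) ahead of the crux-only deciding theorem (planner-plan-lens-HubbardSuperconductivity-transfer-0)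
- 2026-08-26T07:15:53Z · DORMANT — reconciler: no traction for 8.4 d (last activity item-evidence-added at 2026-08-17T21:08:30Z); parked, not closed — `ledger route dormant route-HubbardSupercond (operator:999:3623919)

sub-problem: HubbardSuperconductivity · status: dormant · opened planner-plan-lens-HubbardSuperconductivity-transfer-0 2026-08-16T15:15:14Z · rev 3 · ledger route-HubbardSuperconductivity-LiebTwin
GENERATED by the gate from the ledger (D-0016/17). Provers cite these decls: `theorem foo : Summit.HubbardSuperconductivity.HubbardSuperconductivity.Theses.LiebTwin.<Decl> := …` in Summits/HubbardSuperconductivity/HubbardSuperconductivity/Theorems/<Name>.lean.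
-/

namespace Summit.HubbardSuperconductivity.HubbardSuperconductivity.Theses.LiebTwin

open scoped BigOperators Topology Manifold Classical MeasureTheory ProbabilityTheory Matrix InnerProductSpace ComplexConjugate ContinuousMap
open Filter Set Function TopologicalSpace MeasureTheory

attribute [summit_statement] _root_.HubbardSuperconductivity

open Literature.Hubbard

-- earlier TwinOnsiteCondensation (stmt-HubbardSuperconductivity-15656, replaced 2026-08-16T15:20:32Z -> stmt-HubbardSuperconductivity-15258): retired by None — open Literature.MathematicalPhysics.QuantumLattice in open scoped MatrixOrder Matrix.Norms.L2Operator in ∃ U ∈ Set.Ioc (0 : ℝ) 4, ∃ δ ∈ Set.Icc (1 / 10 : ℝ) (3 / 10), ∃ c : ℝ, 0 < c ∧ ∃ L₀ : ℕ, ∀ (L : ℕ) [NeZero L], L₀ ≤ L → Even L → ∀ φ : Fo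
/-- item stmt-HubbardSuperconductivity-15258 · crux · rank 2 · open · by planner
why it might fail: no engine bounds a purification's pair coherence from below: ρ_↑ of a Fermi-liquid/stripe ground state purifies to a state with only extensive F_s (a determinant purifies to itself), possibly at EVERY box point along some even L; complex combinations of degenerate ground states are included.
sources: LiebPRL1989, Tian1992, doi:10.1103/physrevlett.72.1280, Tian2004, Yang1962, QinEtAl2020
[crux] K2 (card lieb-involution-discordance-map K2, boxed; the attractive-U sibling's LRO statement
transported to the twin): there are (U,δ) ∈ (0,4]×[1/10,3/10], c>0, L₀ such that for every even L ≥
L₀ and EVERY normalised (N_L,0)-sector ground state φ of hubbardTorus 2 L 1 U (n = ⌊(1−δ)L²/2⌋), the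
twin φ̃ = liebVec n (CFC.abs (liebW n φ)) — the canonical purification of the one-species density
matrix — has c·L⁴ ≤ Re⟨φ̃, (pairField sWave L)ᴴ(pairField sWave L) φ̃⟩ (rev 1: stated for every
ground state, not only real flip-definite ones, so that the crux-only deciding theorem needs no
reduction lemma). -/
@[route_item "route-HubbardSuperconductivity-LiebTwin", crux]
def TwinOnsiteCondensation : Prop :=
  open Literature.MathematicalPhysics.QuantumLattice in open scoped MatrixOrder Matrix.Norms.L2Operator in ∃ U ∈ Set.Ioc (0 : ℝ) 4, ∃ δ ∈ Set.Icc (1 / 10 : ℝ) (3 / 10), ∃ c : ℝ, 0 < c ∧ ∃ L₀ : ℕ, ∀ (L : ℕ) [NeZero L], L₀ ≤ L → Even L → ∀ φ : Fock (Orb (FermionTorus 2 L)), star φ ⬝ᵥ φ = 1 → IsGroundStateInSector (hubbardTorus 2 L 1 U) (2 * ⌊(1 - δ) * (L : ℝ) ^ 2 / 2⌋₊) 0 φ → c * (L : ℝ) ^ 4 ≤ (expect ((pairField sWave L)ᴴ * pairField sWave L) (liebVec ⌊(1 - δ) * (L : ℝ) ^ 2 / 2⌋₊ (CFC.abs (liebW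 ⌊(1 - δ) * (L : ℝ) ^ 2 / 2⌋₊ φ)))).re

-- earlier DWavePolarisedDiscordance (stmt-HubbardSuperconductivity-15657, replaced 2026-08-16T15:22:22Z -> stmt-HubbardSuperconductivity-15314): retired by None — open Literature.MathematicalPhysics.QuantumLattice in open scoped MatrixOrder Matrix.Norms.L2Operator in ∀ U ∈ Set.Ioc (0 : ℝ) 4, ∀ δ ∈ Set.Icc (1 / 10 : ℝ) (3 / 10), ∃ κ : ℝ, 0 < κ ∧ ∀ ε : ℝ, 0 < ε → ∃ L₀ : ℕ, ∀ (L : ℕ) [NeZero L], L₀ ≤ L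
/-- item stmt-HubbardSuperconductivity-15314 · crux · rank 3 · open · by planner
why it might fail: macroscopic discordance that is nesting-EVEN (extended-s or d_xy pairing: seen on 10 sites at δ=0.4, outside the box) or sits near the nodal diagonals, or a PDW putting the gain at q≠0, makes the d-gain o(mass) somewhere in (0,4]×[1/10,3/10].
sources: Scalapino1995, RaghuKivelsonScalapino2010, DengEtAl2015, arXiv:1405.2184, QinEtAl2020
[crux] K3' (card lieb-involution-discordance-map K3 + mass, typed q-free; rev 1: every normalised
ground state): for every (U,δ) ∈ (0,4]×[1/10,3/10] there is κ>0 such that for every ε>0, eventually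
in even L, EVERY normalised (N_L,0)-sector ground state φ of hubbardTorus 2 L 1 U satisfies
κ·(F_s(φ̃) − F_s(φ)) − εL⁴ ≤ F_d(φ) − F_d(φ̃), F_g(χ) := Re⟨χ,(pairField g L)ᴴ(pairField g L)χ⟩, φ̃
= liebVec n (CFC.abs (liebW n φ)) the twin — a fixed fraction of the discordance mass is nesting-odd
with |g_d⊗g_d| weight (vacuous where the mass is o(L⁴)). -/
@[route_item "route-HubbardSuperconductivity-LiebTwin", crux]
def DWavePolarisedDiscordance : Prop :=
  open Literature.MathematicalPhysics.QuantumLattice in open scoped MatrixOrder Matrix.Norms.L2Operator in ∀ U ∈ Set.Ioc (0 : ℝ) 4, ∀ δ ∈ Set.Icc (1 / 10 : ℝ) (3 / 10), ∃ κ : ℝ, 0 < κ ∧ ∀ ε : ℝ, 0 < ε → ∃ L₀ : ℕ, ∀ (L : ℕ) [NeZero L], L₀ ≤ L → Even L → ∀ φ : Fock (Orb (FermionTorus 2 L)), star φ ⬝ᵥ φ = 1 → IsGroundStateInSector (hubbardTorus 2 L 1 U) (2 * ⌊(1 - δ) * (L : ℝ) ^ 2 / 2⌋₊) 0 φ → κ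 * ((expect ((pairField sWave L)ᴴ * pairField sWave L) (liebVec ⌊(1 - δ) * (L : ℝ) ^ 2 / 2⌋₊ (CFC.abs (liebW ⌊(1 - δ) * (L : ℝ) ^ 2 / 2⌋₊ φ)))).re - (expect ((pairField sWave L)ᴴ * pairField sWave L) φ).re) - ε * (L : ℝ) ^ 4 ≤ (expect ((pairField dWaveFormFactor L)ᴴ * pairField dWaveFormFactor L) φ).re - (expect ((pairField dWaveFormFactor L)ᴴ * pairField dWaveFormFactor L) (liebVec ⌊(1 - δ) * (L : ℝ) ^ 2 / 2⌋₊ (CFC.abs (liebW ⌊(1 - δ) * (L : ℝ) ^ 2 / 2⌋₊ φ)))).re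

/-- item stmt-HubbardSuperconductivity-0933 · crux · rank 4 · open · by planner
why it might fail: the universal ∀U ∀δ form is open: known only at half filling (KuboKishi1990, χ_pair ≤ 1/U) and in gHF (BachLiebSolovej1994); at weak U every scale is e^(-c/U²), so only an exact sign-of-U argument can work, and Δ_s†Δ_s ≤ L²·D misses doublon condensation.
sources: KuboKishi1990, BachLiebSolovej1994, Yang1989, Zhang1990, RaghuKivelsonScalapino2010
[crux] NO ON-SITE k=0 PAIR CONDENSATE in the repulsive model: for ALL U > 0 and ALL δ ∈ (0,1/2),
every admissible (N_L, S^z=0)-sector ground-state sequence of hubbardTorus 2 L 1 U has L⁻⁴⟨ψ_L,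
P_s†P_s ψ_L⟩ → 0 along even L (P_s = pairField sWave L = √2·Σ_x c_{x↑}c_{x↓}). Physically
uncontroversial (A1g on-site Cooper channel repulsive at O(U); doublons virtual at large U) but
OPEN. Tools suggested by the card: the operator inequality Δ_s†Δ_s ≤ L²·D (hard-core doublon modes)
gives only LRO_s ≤ doublon density — what is missing is 'doublons do not Bose-condense at k = 0'
(doublon pair-momentum distribution); η-vacuum/uniform-pseudospin control; at U<0 the same statement
is FALSE (s-wave BEC), so any proof must use the sign of U. This is the route's specific content:
with A1gSlavingTransfer it removes the whole A1g nearest-neighbour channel from every ground state.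
Card enslaved-a1g-uniform-eta-twin, What it needs (2). -/
@[route_item "route-HubbardSuperconductivity-LiebTwin", crux]
def NoOnsiteODLRO : Prop :=
  ∀ (U δ : ℝ), 0 < U → δ ∈ Set.Ioo (0 : ℝ) (1 / 2) → ∀ (N : ℕ → ℕ) (ψ : ∀ L, Literature.MathematicalPhysics.QuantumLattice.Fock (Literature.MathematicalPhysics.QuantumLattice.Orb (Literature.MathematicalPhysics.QuantumLattice.FermionTorus 2 L))), (∀ L, Even L → N L = 2 * ⌊(1 - δ) * (L : ℝ) ^ 2 / 2⌋₊ ∧ star (ψ L) ⬝ᵥ ψ L = 1 ∧ Literature.MathematicalPhysics.QuantumLattice.IsGroundStateInSector (Literature.MathematicalPhysics.QuantumLattice.hubbardTorus 2 L 1 U) (N L) 0 (ψ L)) → (∀ ε : ℝ, 0 < ε → ∃ L₀ : ℕ, ∀ (L : ℕ) [NeZero L], Even L → L₀ ≤ L → (Literature.MathematicalPhysics.QuantumLattice.expect (Matrix.conjTranspose (Literature.MathematicalPhysics.QuantumLattice.pairField Literature.MathematicalPhysics.QuantumLattice.sWave L) * Literature.MathematicalPhysics.QuantumLattice.pairField Literature.MathematicalPhysics.QuantumLattice.sWave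 L) (ψ L)).re / (L : ℝ) ^ 4 ≤ ε)

/-- item stmt-HubbardSuperconductivity-15381 · support · rank 9 · closed · proved by Summit.HubbardSuperconductivity.HubbardSuperconductivity.Theorems.liebTwin_uniformLROGivesSummitMatrix_proof @ 0d1f68833b96 (prover) · by planner
sources: Scalapino1995, Yang1962
[support] SHARED item stmt-HubbardSuperconductivity-10968 (route IntrinsicLargeN; PROVED:
Theorems/IntrinsicLargeNGlue uniformLROGivesSummitMatrix_proof; identical signature re-filed so the
gate attaches this route): an eventual uniform every-ground-state floor a·L⁴ ≤ Re⟨ψ,Δ_d†Δ_dψ⟩ at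
(U,δ) gives the summit's matrix at (U,δ) (even-side liminf bookkeeping). [difficulty: provable-now] -/
@[route_item "route-HubbardSuperconductivity-LiebTwin"]
def UniformLROGivesSummitMatrix : Prop :=
  ∀ U δ : ℝ, (∃ a : ℝ, 0 < a ∧ ∃ L₀ : ℕ, ∀ (L : ℕ) [NeZero L], L₀ ≤ L → Even L → ∀ ψ : Literature.MathematicalPhysics.QuantumLattice.Fock (Literature.MathematicalPhysics.QuantumLattice.Orb (Literature.MathematicalPhysics.QuantumLattice.FermionTorus 2 L)), star ψ ⬝ᵥ ψ = 1 → Literature.MathematicalPhysics.QuantumLattice.IsGroundStateInSector (Literature.MathematicalPhysics.QuantumLattice.hubbardTorus 2 L 1 U) (2 * ⌊(1 - δ) * (L : ℝ) ^ 2 / 2⌋₊) 0 ψ → a * (L : ℝ) ^ 4 ≤ (Literature.MathematicalPhysics.QuantumLattice.expect ((Literature.MathematicalPhysics.QuantumLattice.pairField Literature.MathematicalPhysics.QuantumLattice.dWaveFormFactor L)ᴴ * Literature.MathematicalPhysics.QuantumLattice.pairField Literature.MathematicalPhysics.QuantumLattice.dWaveFormFactor L) ψ).re) → ∀ (N : ℕ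 → ℕ) (ψ : ∀ L, Literature.MathematicalPhysics.QuantumLattice.Fock (Literature.MathematicalPhysics.QuantumLattice.Orb (Literature.MathematicalPhysics.QuantumLattice.FermionTorus 2 L))), (∀ L, Even L → N L = 2 * ⌊(1 - δ) * (L : ℝ) ^ 2 / 2⌋₊ ∧ star (ψ L) ⬝ᵥ ψ L = 1 ∧ Literature.MathematicalPhysics.QuantumLattice.IsGroundStateInSector (Literature.MathematicalPhysics.QuantumLattice.hubbardTorus 2 L 1 U) (N L) 0 (ψ L)) → Literature.Probability.LatticeModels.HasLongRangeOrder (fun k => Literature.Probability.LatticeModels.halfOpenBox 2 (2 * k)) (fun k => Literature.MathematicalPhysics.QuantumLattice.torusPullback (Literature.MathematicalPhysics.QuantumLattice.pairFieldCorr Literature.MathematicalPhysics.QuantumLattice.dWaveFormFactor ψ) (2 * k))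

-- `UniformLROGivesSummitMatrix` holds: proved by `Summit.HubbardSuperconductivity.HubbardSuperconductivity.Theorems.liebTwin_uniformLROGivesSummitMatrix_proof` @ 0d1f68833b96 (its module imports this route file, so no `_holds` link can be stated here).

/-- item stmt-HubbardSuperconductivity-15658 · support · rank 9 · closed · proved by Summit.HubbardSuperconductivity.HubbardSuperconductivity.Theorems.realFlipDefiniteSuffices_proof @ 40fa6196640d (prover) · by planner
sources: LiebPRL1989, Tasaki2020
[support] Lieb's "W Hermitian WLOG" step (p.116) as an order statement: at fixed (U, L, n), if every
normalised (2n,0)-sector ground state that is real with liebW n φ symmetric or antisymmetric has F_d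
≥ a, then EVERY normalised ground state has F_d ≥ a (H and Δ_d†Δ_d are real and commute with the
transpose involution W ↦ Wᵀ on the sector; the minimum of the compressed quadratic form is attained
on a real transpose-definite vector). [difficulty: provable-now] -/
@[route_item "route-HubbardSuperconductivity-LiebTwin"]
def RealFlipDefiniteSuffices : Prop :=
  open Literature.MathematicalPhysics.QuantumLattice in ∀ (U a : ℝ) (L : ℕ) [NeZero L] (n : ℕ), (∀ φ : Fock (Orb (FermionTorus 2 L)), star φ ⬝ᵥ φ = 1 → IsGroundStateInSector (hubbardTorus 2 L 1 U) (2 * n) 0 φ → (∀ s, star (φ s) = φ s) → ((liebW n φ)ᵀ = liebW n φ ∨ (liebW n φ)ᵀ = -liebW n φ) → a ≤ (expect ((pairField dWaveFormFactor L)ᴴ * pairField dWaveFormFactor L) φ).re) → ∀ ψ : Fock (Orb (FermionTorus 2 L)), star ψ ⬝ᵥ ψ = 1 → IsGroundStateInSector (hubbardTorus 2 L 1 U) (2 * n) 0 ψ → a ≤ (expect ((pairField dWaveFormFactor L)ᴴ * pairField dWaveFormFactor L) ψ).re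

-- `RealFlipDefiniteSuffices` holds: proved by `Summit.HubbardSuperconductivity.HubbardSuperconductivity.Theorems.realFlipDefiniteSuffices_proof` @ 40fa6196640d (its module imports this route file, so no `_holds` link can be stated here).

/-- item stmt-HubbardSuperconductivity-15659 · support · rank 9 · closed · proved by Summit.HubbardSuperconductivity.HubbardSuperconductivity.Theorems.liebTwinFloor_proof @ 89c4ad234a1c (prover) · by planner
sources: LiebPRL1989, Scalapino1995
[support] the floor (provable now): K2 at its point (U,δ), NoOnsiteODLRO turned uniform over ground
states by a selection argument (a bad ground state at infinitely many L assembles into an admissible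
sequence), K3' at (U,δ) with ε = κc/4 and F_d(φ̃) ≥ 0 give F_d(φ) ≥ (κc/4)L⁴ for every real
flip-definite normalised ground state eventually; RealFlipDefiniteSuffices extends it to every
ground state; 0<U≤4 and [1/10,3/10] ⊂ (0,1/2) give the side conditions. [difficulty: provable-now] -/
@[route_item "route-HubbardSuperconductivity-LiebTwin"]
def LiebTwinFloor : Prop :=
  TwinOnsiteCondensation → NoOnsiteODLRO → DWavePolarisedDiscordance → RealFlipDefiniteSuffices → ∃ U : ℝ, 0 < U ∧ ∃ δ ∈ Set.Ioo (0 : ℝ) (1 / 2), ∃ a : ℝ, 0 < a ∧ ∃ L₀ : ℕ, ∀ (L : ℕ) [NeZero L], L₀ ≤ L → Even L → ∀ ψ : Literature.MathematicalPhysics.QuantumLattice.Fock (Literature.MathematicalPhysics.QuantumLattice.Orb (Literature.MathematicalPhysics.QuantumLattice.FermionTorus 2 L)), star ψ ⬝ᵥ ψ = 1 → Literature.MathematicalPhysics.QuantumLattice.IsGroundStateInSector (Literature.MathematicalPhysics.QuantumLattice.hubbardTorus 2 L 1 U) (2 * ⌊(1 - δ) * (L : ℝ) ^ 2 / 2⌋₊)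 0 ψ → a * (L : ℝ) ^ 4 ≤ (Literature.MathematicalPhysics.QuantumLattice.expect ((Literature.MathematicalPhysics.QuantumLattice.pairField Literature.MathematicalPhysics.QuantumLattice.dWaveFormFactor L)ᴴ * Literature.MathematicalPhysics.QuantumLattice.pairField Literature.MathematicalPhysics.QuantumLattice.dWaveFormFactor L) ψ).re

-- `LiebTwinFloor` holds: proved by `Summit.HubbardSuperconductivity.HubbardSuperconductivity.Theorems.liebTwinFloor_proof` @ 89c4ad234a1c (its module imports this route file, so no `_holds` link can be stated here).

/-- item stmt-HubbardSuperconductivity-15660 · support · rank 9 · closed · proved by Summit.HubbardSuperconductivity.HubbardSuperconductivity.Theorems.onsiteRectificationMonotone_proof @ 5bfb3190645c (prover) · by planner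
sources: LiebPRL1989, Yang1962
[support] identity (I3) in inequality form (provable now): for every real φ in the (n,n) sector with
symmetric Lieb matrix, F_s(φ̃) ≥ F_s(φ) — on-site pair annihilation acts as W ↦ ±Σ_x a_x W a_xᵀ, and
F_s(|W|) − F_s(W) = 2Σ_(x,y)(‖W₊^½ a_xᵀa_y W₋^½‖² + ‖W₋^½ a_xᵀa_y W₊^½‖²) ≥ 0 (the total discordance
mass). [difficulty: provable-now] -/
@[route_item "route-HubbardSuperconductivity-LiebTwin"]
def OnsiteRectificationMonotone : Prop :=
  open Literature.MathematicalPhysics.QuantumLattice in open scoped MatrixOrder Matrix.Norms.L2Operator in ∀ (L : ℕ) [NeZero L] (n : ℕ) (φ : Fock (Orb (FermionTorus 2 L))), (∀ s, star (φ s) = φ s) → IsInSector n n φ → (liebW n φ)ᵀ = liebW n φ → (expect ((pairField sWave L)ᴴ * pairField sWave L) φ).re ≤ (expect ((pairField sWave L)ᴴ * pairField sWave L) (liebVec n (CFC.abs (liebW n φ)))).re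

-- `OnsiteRectificationMonotone` holds: proved by `Summit.HubbardSuperconductivity.HubbardSuperconductivity.Theorems.onsiteRectificationMonotone_proof` @ 5bfb3190645c (its module imports this route file, so no `_holds` link can be stated here).

/-- item stmt-HubbardSuperconductivity-15661 · support · rank 9 · closed · proved by Summit.HubbardSuperconductivity.HubbardSuperconductivity.Theorems.rectificationRaisesEnergy_proof @ cb6848f1975b (prover) · by planner
sources: LiebPRL1989, BachLiebSolovej1994
[support] the sibling's step that BREAKS, made a theorem (provable now from Lieb eq. (3) and Tr WLWL
≤ Tr|W|L|W|L, tree LiebSpinReflection.re_trace_unitConj_mul_le): for U ≥ 0 and every real φ in the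
(n,n) sector with symmetric Lieb matrix, the twin has the same norm and energy Re⟨φ̃,Hφ̃⟩ ≥
Re⟨φ,Hφ⟩, H = hubbardTorus 2 L 1 U — rectification never lowers the repulsive energy, so Lieb's
positivity cannot be reached variationally and must be used as a reference. [difficulty:
provable-now] -/
@[route_item "route-HubbardSuperconductivity-LiebTwin"]
def RectificationRaisesEnergy : Prop :=
  open Literature.MathematicalPhysics.QuantumLattice in open scoped MatrixOrder Matrix.Norms.L2Operator in ∀ (U : ℝ), 0 ≤ U → ∀ (L : ℕ) [NeZero L] (n : ℕ) (φ : Fock (Orb (FermionTorus 2 L))), (∀ s, star (φ s) = φ s) → IsInSector n n φ → (liebW n φ)ᵀ = liebW n φ → let φt : Fock (Orb (FermionTorus 2 L)) := liebVec n (CFC.abs (liebW n φ)); star φt ⬝ᵥ φt = star φ ⬝ᵥ φ ∧ (expect (hubbardTorus 2 L 1 U) φ).re ≤ (expect (hubbardTorus 2 L 1 U) φt).re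

-- `RectificationRaisesEnergy` holds: proved by `Summit.HubbardSuperconductivity.HubbardSuperconductivity.Theorems.rectificationRaisesEnergy_proof` @ cb6848f1975b (its module imports this route file, so no `_holds` link can be stated here).

/-- item stmt-HubbardSuperconductivity-15662 · assembly · rank 1 · closed · proved by Summit.HubbardSuperconductivity.HubbardSuperconductivity.Theorems.liebTwin_assembly_proof @ f1757b98b06c (prover) · by planner
sources: LiebPRL1989, Scalapino1995
[assembly] TwinOnsiteCondensation → DWavePolarisedDiscordance → NoOnsiteODLRO →
RealFlipDefiniteSuffices → LiebTwinFloor → UniformLROGivesSummitMatrix → HubbardSuperconductivity. -/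
@[route_item "route-HubbardSuperconductivity-LiebTwin"]
def Assembly : Prop :=
  TwinOnsiteCondensation → DWavePolarisedDiscordance → NoOnsiteODLRO → RealFlipDefiniteSuffices → LiebTwinFloor → UniformLROGivesSummitMatrix → _root_.HubbardSuperconductivity

-- `Assembly` holds: proved by `Summit.HubbardSuperconductivity.HubbardSuperconductivity.Theorems.liebTwin_assembly_proof` @ f1757b98b06c (its module imports this route file, so no `_holds` link can be stated here).

/-! D-0027 §2.1 — DECIDING THEOREM (planner-authored via `route open/edit --closes-file`; by planner-rbadge-HubbardSuperconductivity-LiebTw-b9af3777-0 2026-08-16T15:36:12Z):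
its hypotheses are this route's items and its conclusion the sub-problem Statement (glue_lint), and it elaborates with this file. -/

@[closes "route-HubbardSuperconductivity-LiebTwin"] theorem closes (hK2 : TwinOnsiteCondensation) (hK3 : DWavePolarisedDiscordance)
    (hNo : NoOnsiteODLRO) : _root_.HubbardSuperconductivity := by
  classical
  -- K2: at some box point `(U, δ)` the twin of EVERY normalised sector ground state condenses on-site
  obtain ⟨U, hU, δ, hδ, c, hc, L₀, h2⟩ := hK2
  have hU0 : 0 < U := hU.1
  have hδ' : δ ∈ Set.Ioo (0 : ℝ) (1 / 2) := ⟨by linarith [hδ.1], by linarith [hδ.2]⟩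
  -- K3' at `(U, δ)` with `ε := κc/4`
  obtain ⟨κ, hκ, h3⟩ := hK3 U hU δ hδ
  obtain ⟨L₁, h3⟩ := h3 (κ * c / 4) (by positivity)
  -- the summit at `(U, δ)`: every admissible ground-state sequence `ψ` has d-wave pair-field LRO
  unfold _root_.HubbardSuperconductivity Literature.Hubbard.DWaveSuperconductivityHubbard
  refine ⟨U, hU0, δ, hδ', fun N ψ hyp => ?_⟩
  -- `NoOnsiteODLRO` along this very sequence, with `ε := c/4`
  obtain ⟨L₂, hNo'⟩ := hNo U δ hU0 hδ' N ψ hyp (c / 4) (by positivity)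
  -- (a) `Re⟨χ, Δ_d†Δ_d χ⟩ = ‖Δ_d χ‖² ≥ 0` for every vector `χ` (used for the twin)
  have hnn : ∀ (L : ℕ) [NeZero L] (χ : Literature.MathematicalPhysics.QuantumLattice.Fock (Literature.MathematicalPhysics.QuantumLattice.Orb (Literature.MathematicalPhysics.QuantumLattice.FermionTorus 2 L))),
      0 ≤ (Literature.MathematicalPhysics.QuantumLattice.expect ((Literature.MathematicalPhysics.QuantumLattice.pairField Literature.MathematicalPhysics.QuantumLattice.dWaveFormFactor L)ᴴ *
        Literature.MathematicalPhysics.QuantumLattice.pairField Literature.MathematicalPhysics.QuantumLattice.dWaveFormFactor L) χ).re := by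
    intro L _ χ
    rw [Literature.MathematicalPhysics.QuantumLattice.PosSemidefTrace.expect_conjTranspose_mul, ← Literature.MathematicalPhysics.QuantumLattice.norm_toLp_sq_eq_re]
    positivity
  -- (b) the floor `(κc/4)·L⁴ ≤ Re⟨ψ_L, Δ_d†Δ_d ψ_L⟩` along the sequence, eventually in even `L`:
  --     κ(F_s(φ̃) − F_s(ψ)) − (κc/4)L⁴ ≤ F_d(ψ) − F_d(φ̃), F_d(φ̃) ≥ 0, F_s(φ̃) ≥ cL⁴, F_s(ψ) ≤ (c/4)L⁴
  have floor : ∀ (L : ℕ) [NeZero L], L₀ ≤ L → L₁ ≤ L → L₂ ≤ L → Even L →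
      κ * c / 4 * (L : ℝ) ^ 4 ≤
        (Literature.MathematicalPhysics.QuantumLattice.expect ((Literature.MathematicalPhysics.QuantumLattice.pairField Literature.MathematicalPhysics.QuantumLattice.dWaveFormFactor L)ᴴ *
          Literature.MathematicalPhysics.QuantumLattice.pairField Literature.MathematicalPhysics.QuantumLattice.dWaveFormFactor L) (ψ L)).re := by
    intro L _ hL0 hL1 hL2 hE
    obtain ⟨hN, hu, hgs⟩ := hyp L hE
    rw [hN] at hgs
    have h2' := h2 L hL0 hE (ψ L) hu hgs
    have h3' := h3 L hL1 hE (ψ L) hu hgs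
    have hLpos : (0 : ℝ) < (L : ℝ) := Nat.cast_pos.2 (Nat.pos_of_ne_zero (NeZero.ne L))
    have hL4 : (0 : ℝ) < (L : ℝ) ^ 4 := pow_pos hLpos 4
    have hFs := (div_le_iff₀ hL4).1 (hNo' L hE hL2)
    have hX : 0 ≤ κ * c * (L : ℝ) ^ 4 := (mul_pos (mul_pos hκ hc) hL4).le
    have aux : ∀ A B D E X : ℝ, κ * (A - B) - κ * c / 4 * X ≤ D - E → 0 ≤ E → c * X ≤ A →
        B ≤ c / 4 * X → 0 ≤ κ * c * X → κ * c / 4 * X ≤ D := by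
      intro A B D E X i1 i2 i3 i4 i5
      have j3 := mul_le_mul_of_nonneg_left i3 hκ.le
      have j4 := mul_le_mul_of_nonneg_left i4 hκ.le
      nlinarith
    exact aux _ _ _ _ _ h3' (hnn L _) h2' hFs hX
  -- (c) the LRO term at a nonzero side `L` is `Re⟨ψ_L, Δ_d†Δ_d ψ_L⟩ / L⁴`
  have hterm : ∀ (L : ℕ) [NeZero L],
      (∑ x ∈ Literature.Probability.LatticeModels.halfOpenBox 2 L, ∑ y ∈ Literature.Probability.LatticeModels.halfOpenBox 2 L,
          Literature.MathematicalPhysics.QuantumLattice.torusPullback (Literature.MathematicalPhysics.QuantumLattice.pairFieldCorr Literature.MathematicalPhysics.QuantumLattice.dWaveFormFactor ψ) L x y) /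
        ((Literature.Probability.LatticeModels.halfOpenBox 2 L).card : ℝ) ^ 2 =
      (Literature.MathematicalPhysics.QuantumLattice.expect ((Literature.MathematicalPhysics.QuantumLattice.pairField Literature.MathematicalPhysics.QuantumLattice.dWaveFormFactor L)ᴴ *
          Literature.MathematicalPhysics.QuantumLattice.pairField Literature.MathematicalPhysics.QuantumLattice.dWaveFormFactor L) (ψ L)).re / (L : ℝ) ^ 4 := by
    intro L _
    obtain ⟨M, rfl⟩ := Nat.exists_eq_add_one_of_ne_zero (NeZero.ne L)
    exact Literature.MathematicalPhysics.QuantumLattice.torusLROSeq_pairFieldCorr_succ Literature.MathematicalPhysics.QuantumLattice.dWaveFormFactor ψ M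
  -- (d) a-priori cap `Re⟨ψ_L, Δ_d†Δ_d ψ_L⟩ ≤ C_d² L⁴` for unit `ψ_L` (keeps the real `liminf` honest)
  have hcap : ∀ (L : ℕ) [NeZero L], star (ψ L) ⬝ᵥ ψ L = 1 →
      (Literature.MathematicalPhysics.QuantumLattice.expect ((Literature.MathematicalPhysics.QuantumLattice.pairField Literature.MathematicalPhysics.QuantumLattice.dWaveFormFactor L)ᴴ *
          Literature.MathematicalPhysics.QuantumLattice.pairField Literature.MathematicalPhysics.QuantumLattice.dWaveFormFactor L) (ψ L)).re ≤
        (∑ e ∈ insert 0 Literature.MathematicalPhysics.QuantumLattice.unitSteps,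
            ‖((Literature.MathematicalPhysics.QuantumLattice.dWaveFormFactor e / Real.sqrt 2 : ℝ) : ℂ)‖ * 2) ^ 2 * (L : ℝ) ^ 4 := by
    intro L _ hu
    obtain ⟨M, rfl⟩ := Nat.exists_eq_add_one_of_ne_zero (NeZero.ne L)
    rw [← Literature.MathematicalPhysics.QuantumLattice.sum_pairFieldCorr_succ Literature.MathematicalPhysics.QuantumLattice.dWaveFormFactor ψ M]
    calc ∑ x : Literature.Probability.LatticeModels.TorusSite 2 (M + 1), ∑ y, Literature.MathematicalPhysics.QuantumLattice.pairFieldCorr Literature.MathematicalPhysics.QuantumLattice.dWaveFormFactor ψ (M + 1) x y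
        ≤ ∑ _x : Literature.Probability.LatticeModels.TorusSite 2 (M + 1), ∑ _y : Literature.Probability.LatticeModels.TorusSite 2 (M + 1),
            (∑ e ∈ insert 0 Literature.MathematicalPhysics.QuantumLattice.unitSteps,
              ‖((Literature.MathematicalPhysics.QuantumLattice.dWaveFormFactor e / Real.sqrt 2 : ℝ) : ℂ)‖ * 2) ^ 2 :=
          Finset.sum_le_sum fun x _ => Finset.sum_le_sum fun y _ =>
            Literature.MathematicalPhysics.QuantumLattice.pairFieldCorr_succ_le Literature.MathematicalPhysics.QuantumLattice.dWaveFormFactor ψ M hu x y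
      _ = (∑ e ∈ insert 0 Literature.MathematicalPhysics.QuantumLattice.unitSteps,
              ‖((Literature.MathematicalPhysics.QuantumLattice.dWaveFormFactor e / Real.sqrt 2 : ℝ) : ℂ)‖ * 2) ^ 2 *
            ((M + 1 : ℕ) : ℝ) ^ 4 := by
          simp only [Finset.sum_const, Finset.card_univ, Fintype.card_pi, ZMod.card,
            Finset.prod_const, Fintype.card_fin, nsmul_eq_mul]
          push_cast
          ring
  -- (e) even-side `liminf` bookkeeping (Friedli–Velenik §3.7.2; Scalapino §2 eq. (2.4))
  change 0 < Filter.liminf (fun k : ℕ =>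
      (∑ x ∈ Literature.Probability.LatticeModels.halfOpenBox 2 (2 * k), ∑ y ∈ Literature.Probability.LatticeModels.halfOpenBox 2 (2 * k),
          Literature.MathematicalPhysics.QuantumLattice.torusPullback (Literature.MathematicalPhysics.QuantumLattice.pairFieldCorr Literature.MathematicalPhysics.QuantumLattice.dWaveFormFactor ψ) (2 * k) x y) /
        ((Literature.Probability.LatticeModels.halfOpenBox 2 (2 * k)).card : ℝ) ^ 2) Filter.atTop
  have hside : ∀ k : ℕ, 1 ≤ k → (0 : ℝ) < ((2 * k : ℕ) : ℝ) ^ 4 :=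
    fun k hk => pow_pos (Nat.cast_pos.2 (by omega)) 4
  have hev : ∀ᶠ k : ℕ in Filter.atTop, κ * c / 4 ≤
      (∑ x ∈ Literature.Probability.LatticeModels.halfOpenBox 2 (2 * k), ∑ y ∈ Literature.Probability.LatticeModels.halfOpenBox 2 (2 * k),
          Literature.MathematicalPhysics.QuantumLattice.torusPullback (Literature.MathematicalPhysics.QuantumLattice.pairFieldCorr Literature.MathematicalPhysics.QuantumLattice.dWaveFormFactor ψ) (2 * k) x y) /
        ((Literature.Probability.LatticeModels.halfOpenBox 2 (2 * k)).card : ℝ) ^ 2 := by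
    refine Filter.eventually_atTop.2 ⟨L₀ + L₁ + L₂ + 1, fun k hk => ?_⟩
    haveI : NeZero (2 * k) := ⟨by omega⟩
    rw [hterm, le_div_iff₀ (hside k (by omega))]
    exact floor (2 * k) (by omega) (by omega) (by omega) (even_two_mul k)
  have hev' : ∀ᶠ k : ℕ in Filter.atTop,
      (∑ x ∈ Literature.Probability.LatticeModels.halfOpenBox 2 (2 * k), ∑ y ∈ Literature.Probability.LatticeModels.halfOpenBox 2 (2 * k),
          Literature.MathematicalPhysics.QuantumLattice.torusPullback (Literature.MathematicalPhysics.QuantumLattice.pairFieldCorr Literature.MathematicalPhysics.QuantumLattice.dWaveFormFactor ψ) (2 * k) x y) /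
        ((Literature.Probability.LatticeModels.halfOpenBox 2 (2 * k)).card : ℝ) ^ 2 ≤
      (∑ e ∈ insert 0 Literature.MathematicalPhysics.QuantumLattice.unitSteps,
          ‖((Literature.MathematicalPhysics.QuantumLattice.dWaveFormFactor e / Real.sqrt 2 : ℝ) : ℂ)‖ * 2) ^ 2 := by
    refine Filter.eventually_atTop.2 ⟨1, fun k hk => ?_⟩
    haveI : NeZero (2 * k) := ⟨by omega⟩
    obtain ⟨-, hu, -⟩ := hyp (2 * k) (even_two_mul k)
    rw [hterm, div_le_iff₀ (hside k hk)]
    exact hcap (2 * k) hu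
  exact lt_of_lt_of_le (by positivity)
    (Filter.le_liminf_of_le (Filter.isCoboundedUnder_ge_of_eventually_le _ hev') hev)

end Summit.HubbardSuperconductivity.HubbardSuperconductivity.Theses.LiebTwin
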